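import Mathlib
import Literature.Analysis.PDE.NearInverseSquareFarExact
import Literature.Analysis.PDE.NearInverseSquareFarKernelData
import Literature.Analysis.PDE.Wave1DEnergySeminorm

/-!
# Small facts for the per-power far kernel adapter

Analysis/PDE support file (everything proved). For the smooth `ι = 1/x` on `[½,∞)` and a
near-inverse-square potential `W` (`|W − n(n+1)/x²| ≤ ε x^{-5/2}` on `[½,∞)`, `ε ≤ ¼`, `W ≥ 0`):
gluing two `ℕ`-indexed families into a `Fin (a+b)`-sum (`sum_fin_glue`); the pieces of an integrable
energy density, also for differences of admissible data (`energy_pieces`, `energy_pieces_sub`);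
`W ≤ (n(n+1)+1) ι²` on `[1,∞)`; integrability on `(1,∞)` and pointwise bounds by `const · ι²` of
`((ι^m)')²`, `W ι^{2m}`, `ι^{2m}` (`m ≥ 1`). Used by `NearInverseSquareFarPowerAdapter`
(route PhotonSphereChannels, `FixedModeChannels`, stmt-FinalStateConjecture-10048). Folklore.
-/

noncomputable section

namespace Literature.Analysis.PDE

open Set Filter MeasureTheory Finset Literature.Analysis.ODE Literature.Analysis.Approximation
open scoped _root_.Topology

variable {ι : ℝ → ℝ}

/-- Gluing two `ℕ`-indexed families into one `Fin (a + b)`-indexed sum. [folklore] -/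
theorem sum_fin_glue {X : Type*} [AddCommMonoid X] (a b : ℕ) (u v : ℕ → X) :
    ∑ i : Fin (a + b), (if (i : ℕ) < a then u i else v ((i : ℕ) - a))
      = ∑ k ∈ Finset.range a, u k + ∑ k ∈ Finset.range b, v k := by
  rw [Fin.sum_univ_eq_sum_range (fun i => if i < a then u i else v (i - a)) (a + b),
    Finset.sum_range_add]
  congr 1
  · exact Finset.sum_congr rfl fun k hk => by rw [if_pos (Finset.mem_range.1 hk)]
  · exact Finset.sum_congr rfl fun k _ => by
      rw [if_neg (by omega), Nat.add_sub_cancel_left]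

/-- The three pieces of an integrable energy density of data `(h, g)` (`h ∈ C¹`, `g` continuous) are
integrable. [folklore] -/
theorem energy_pieces {W h g : ℝ → ℝ} (hW : Continuous W) (hW0 : ∀ x, 0 ≤ W x) (hh : ContDiff ℝ 1 h)
    (hg : Continuous g) {S : Set ℝ}
    (hi : IntegrableOn (fun x => deriv h x ^ 2 + W x * h x ^ 2 + g x ^ 2) S) :
    IntegrableOn (fun x => deriv h x ^ 2) S ∧ IntegrableOn (fun x => W x * h x ^ 2) S ∧
    IntegrableOn (fun x => g x ^ 2) S := by
  have c1 : Continuous (deriv h) := hh.continuous_deriv le_rfl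
  refine ⟨?_, ?_, ?_⟩
  · refine Integrable.mono' hi ((c1.pow 2).aestronglyMeasurable) (ae_of_all _ fun x => ?_)
    rw [Real.norm_eq_abs, abs_of_nonneg (sq_nonneg _)]
    nlinarith [mul_nonneg (hW0 x) (sq_nonneg (h x)), sq_nonneg (g x)]
  · refine Integrable.mono' hi ((hW.mul (hh.continuous.pow 2)).aestronglyMeasurable) (ae_of_all _ fun x => ?_)
    rw [Real.norm_eq_abs, abs_of_nonneg (mul_nonneg (hW0 x) (sq_nonneg _))]
    nlinarith [sq_nonneg (deriv h x), sq_nonneg (g x)]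
  · refine Integrable.mono' hi ((hg.pow 2).aestronglyMeasurable) (ae_of_all _ fun x => ?_)
    rw [Real.norm_eq_abs, abs_of_nonneg (sq_nonneg _)]
    nlinarith [mul_nonneg (hW0 x) (sq_nonneg (h x)), sq_nonneg (deriv h x)]


section IotaFacts

variable (hι : ContDiff ℝ (⊤ : ℕ∞) ι) (hιeq : ∀ x : ℝ, 1 / 2 ≤ x → ι x = x⁻¹)
include hι hιeq

/-- `((ι^m)')²` is integrable on `(1,∞)` and at most `m² ι²` there. [folklore] -/
theorem integrableOn_deriv_iota_pow_sq (m : ℕ) :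
    IntegrableOn (fun x => deriv (fun y => ι y ^ m) x ^ 2) (Ioi 1) ∧
    ∀ x : ℝ, 1 < x → deriv (fun y => ι y ^ m) x ^ 2 ≤ (m : ℝ) ^ 2 * ι x ^ 2 := by
  have hpt : ∀ x : ℝ, 1 < x → deriv (fun y => ι y ^ m) x ^ 2 = (m : ℝ) ^ 2 * ι x ^ (2 * m + 2) := by
    intro x hx
    rw [deriv_iota_pow hιeq m (by linarith)]; ring
  refine ⟨?_, fun x hx => ?_⟩
  · have h := (integrableOn_iota_pow hι hιeq (p := 2 * m + 2) (by omega)).const_mul ((m : ℝ) ^ 2)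
    exact (integrableOn_congr_fun (fun x hx => hpt x hx) measurableSet_Ioi).2 h
  · rw [hpt x hx]
    obtain ⟨h0, h1, -⟩ := iota_pow_le hιeq hx.le (p := 2) le_rfl
    have : ι x ^ (2 * m + 2) ≤ ι x ^ 2 := pow_le_pow_of_le_one h0.le h1 (by omega)
    exact mul_le_mul_of_nonneg_left this (sq_nonneg _)

omit hι in
/-- A near-inverse-square potential is at most `(n(n+1)+1) ι²` on `[1,∞)`. [folklore] -/
theorem nearInverseSquare_le_iota_sq {W : ℝ → ℝ} {n : ℕ} {ε : ℝ} (hε0 : 0 ≤ ε) (hε : ε ≤ 1 / 4)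
    (hW0 : ∀ x, 0 ≤ W x)
    (hclose : ∀ x : ℝ, 1 / 2 ≤ x → |W x - (n : ℝ) * ((n : ℝ) + 1) / x ^ 2| ≤ ε * x ^ (-(5 : ℝ) / 2))
    {x : ℝ} (hx : 1 ≤ x) : W x ≤ ((n : ℝ) * ((n : ℝ) + 1) + 1) * ι x ^ 2 := by
  obtain ⟨-, -, h3, -⟩ := nearInverseSquare_pointwise hε0 hε hW0 hclose hx
  rw [hιeq x (by linarith), inv_pow]
  have hx2 : 0 < (x ^ 2)⁻¹ := by positivity
  calc W x ≤ (n : ℝ) * ((n : ℝ) + 1) / x ^ 2 + ε * (x ^ 2)⁻¹ := h3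
    _ ≤ ((n : ℝ) * ((n : ℝ) + 1) + 1) * (x ^ 2)⁻¹ := by rw [div_eq_mul_inv]; nlinarith

/-- `W ι^{2m}` is integrable on `(1,∞)` and at most `(n(n+1)+1) ι²` there. [folklore] -/
theorem integrableOn_W_mul_iota_pow_sq {W : ℝ → ℝ} (hW : Continuous W) {n : ℕ} {ε : ℝ} (hε0 : 0 ≤ ε)
    (hε : ε ≤ 1 / 4) (hW0 : ∀ x, 0 ≤ W x)
    (hclose : ∀ x : ℝ, 1 / 2 ≤ x → |W x - (n : ℝ) * ((n : ℝ) + 1) / x ^ 2| ≤ ε * x ^ (-(5 : ℝ) / 2))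
    (m : ℕ) :
    IntegrableOn (fun x => W x * (ι x ^ m) ^ 2) (Ioi 1) ∧
    ∀ x : ℝ, 1 < x → W x * (ι x ^ m) ^ 2 ≤ ((n : ℝ) * ((n : ℝ) + 1) + 1) * ι x ^ 2 := by
  have hpt : ∀ x : ℝ, 1 < x → W x * (ι x ^ m) ^ 2 ≤ ((n : ℝ) * ((n : ℝ) + 1) + 1) * ι x ^ 2 := by
    intro x hx
    obtain ⟨h0, h1, -⟩ := iota_pow_le hιeq hx.le (p := 2) le_rfl
    have hpm : (ι x ^ m) ^ 2 ≤ 1 := by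
      rw [← pow_mul]; exact pow_le_one₀ h0.le h1
    calc W x * (ι x ^ m) ^ 2 ≤ ((n : ℝ) * ((n : ℝ) + 1) + 1) * ι x ^ 2 * (ι x ^ m) ^ 2 :=
          mul_le_mul_of_nonneg_right (nearInverseSquare_le_iota_sq hιeq hε0 hε hW0 hclose hx.le)
            (by positivity)
      _ ≤ ((n : ℝ) * ((n : ℝ) + 1) + 1) * ι x ^ 2 := by
          have : 0 ≤ ((n : ℝ) * ((n : ℝ) + 1) + 1) * ι x ^ 2 := by positivity
          nlinarith
  refine ⟨?_, hpt⟩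
  refine Integrable.mono' ((integrableOn_iota_pow hι hιeq (p := 2) le_rfl).const_mul
    ((n : ℝ) * ((n : ℝ) + 1) + 1)) ((hW.mul ((hι.continuous.pow m).pow 2)).aestronglyMeasurable)
    ((ae_restrict_iff' measurableSet_Ioi).2 (ae_of_all _ fun x hx => ?_))
  rw [Real.norm_eq_abs, abs_of_nonneg (mul_nonneg (hW0 x) (sq_nonneg _))]
  exact hpt x hx

end IotaFacts

/-- Pieces of the energy density of a DIFFERENCE of admissible data. [folklore] -/
theorem energy_pieces_sub {W h₁ h₂ g₁ g₂ : ℝ → ℝ} (hW : Continuous W) (hW0 : ∀ x, 0 ≤ W x)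
    (hh₁ : ContDiff ℝ 1 h₁) (hh₂ : ContDiff ℝ 1 h₂) (hg₁ : Continuous g₁) (hg₂ : Continuous g₂)
    {S : Set ℝ} (hS : MeasurableSet S)
    (i₁ : IntegrableOn (fun x => deriv h₁ x ^ 2) S) (i₂ : IntegrableOn (fun x => W x * h₁ x ^ 2) S)
    (i₃ : IntegrableOn (fun x => g₁ x ^ 2) S) (j₁ : IntegrableOn (fun x => deriv h₂ x ^ 2) S)
    (j₂ : IntegrableOn (fun x => W x * h₂ x ^ 2) S) (j₃ : IntegrableOn (fun x => g₂ x ^ 2) S) :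
    IntegrableOn (fun x => deriv (fun y => h₁ y - h₂ y) x ^ 2) S ∧
    IntegrableOn (fun x => W x * (h₁ x - h₂ x) ^ 2) S ∧
    IntegrableOn (fun x => (g₁ x - g₂ x) ^ 2) S := by
  have hh₂' : ContDiff ℝ 1 fun y => -h₂ y := hh₂.neg
  have hg₂' : Continuous fun y => -g₂ y := hg₂.neg
  have j₁' : IntegrableOn (fun x => deriv (fun y => -h₂ y) x ^ 2) S := by
    simp only [deriv.fun_neg, neg_sq]; exact j₁
  have j₂' : IntegrableOn (fun x => W x * (-h₂ x) ^ 2) S := by simp only [neg_sq]; exact j₂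
  have j₃' : IntegrableOn (fun x => (-g₂ x) ^ 2) S := by simp only [neg_sq]; exact j₃
  obtain ⟨hint, -⟩ := sqrt_energy_add_le hW hW0 hh₁ hh₂' hg₁ hg₂' hS i₁ i₂ i₃ j₁' j₂' j₃'
  have hsum1 : ContDiff ℝ 1 fun y => h₁ y + -h₂ y := hh₁.add hh₂'
  obtain ⟨k₁, k₂, k₃⟩ := energy_pieces hW hW0 hsum1 (hg₁.add hg₂') hint
  simp only [← sub_eq_add_neg] at k₁ k₂ k₃
  exact ⟨k₁, k₂, k₃⟩


section IotaFacts2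

variable (hι : ContDiff ℝ (⊤ : ℕ∞) ι) (hιeq : ∀ x : ℝ, 1 / 2 ≤ x → ι x = x⁻¹)
include hι hιeq

/-- `ι^{2m}` is integrable on `(1,∞)` and at most `ι²` there (`m ≥ 1`). [folklore] -/
theorem integrableOn_iota_pow_sq {m : ℕ} (hm : 1 ≤ m) :
    IntegrableOn (fun x => (ι x ^ m) ^ 2) (Ioi 1) ∧ ∀ x : ℝ, 1 < x → (ι x ^ m) ^ 2 ≤ ι x ^ 2 := by
  have hpt : ∀ x : ℝ, 1 < x → (ι x ^ m) ^ 2 ≤ ι x ^ 2 := by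
    intro x hx
    obtain ⟨h0, h1, -⟩ := iota_pow_le hιeq hx.le (p := 2) le_rfl
    rw [← pow_mul]
    exact pow_le_pow_of_le_one h0.le h1 (by omega)
  refine ⟨?_, hpt⟩
  refine Integrable.mono' (integrableOn_iota_pow hι hιeq (p := 2) le_rfl)
    (((hι.continuous.pow m).pow 2).aestronglyMeasurable)
    ((ae_restrict_iff' measurableSet_Ioi).2 (ae_of_all _ fun x hx => ?_))
  rw [Real.norm_eq_abs, abs_of_nonneg (sq_nonneg _)]
  exact hpt x hx

end IotaFacts2

end Literature.Analysis.PDE
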